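import Literature.NumberTheory.Automorphic.Liu2021.Def45RMuExists
import HarnessLib

/-!
# [Liu 2021] Definition 4.5 (2), fourth bullet — non-vacuity, printed shape and consumer forms: companion of `Def45RMuExists`

Y. Liu, *Fourier–Jacobi cycles and arithmetic relative trace formula*, Camb. J. Math. **9** (2021) = arXiv:2102.11518
[Liu2021]; TeX source `FJcycle.tex` (md5 `6db49a74122d…`), §4.1, Def. 4.5 (2) fourth bullet (l. 1957): «… there exist an
element `β ∈ M_μ` and an isomorphism `c […]` such that for every `x, y ∈ M_μ ⊗_ℚ E`, we have
`c(⟨r_μ(x), r_μ(y)⟩_λ) = Tr_{M_μ ⊗_ℚ E/E}(x β ȳ)`»; proof of Prop. 4.6 (1), l. 1982 «The existence of `r_μ` is obvious».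
Red-team WATCH W1, r-half (pub-hodgecm2 `HOME/pinning/HCMISOG-TABLE.md` sub-row (CP-S4c-P)).

`Liu2021/Def45RMuExists` proves: at every face of a Galois CM field, for every abstract de Rham datum `(H, e, B)` for `μ`
(free rank-one `L = F ⊗_ℚ M_μ`-module with an alternating non-degenerate `F`-bilinear form satisfying the third-bullet
adjunction) and every PRESCRIBED `β ∈ M_μ` with `ρ β = -β ≠ 0`, an `L`-linear `r : L ≃ H` has `B(r x, r y) = Tr(x (1 ⊗ β) ȳ)`.
This companion records (notation as there; `ȳ = (1 ⊗ ρ) y`):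
* `exists_map_eq_neg_ne_zero_muAlgValueField` — such `β` EXIST (`M_μ` is a CM field, tree
  `IsConjugateSymplectic.isCMField_muAlgValueField`; complex conjugation of a CM field is not the identity, Mathlib
  `IsCMField.complexConj_ne_one`; `β := w - ρ w`);
* `exists_beta_linearEquiv_forall₂_eq_trace_muAlgValueField` — the PRINTED SHAPE «there exist an element `β ∈ M_μ` and … such
  that …» (no prescribed `β`; Liu's `c` absorbed into `B`);
* `rMu_hypotheses_satisfiable` — JOINT SATISFIABILITY of the hypotheses of the main theorem at Liu's data (no vacuous
  antecedent, T5-style): the target datum `H := L`, `e := id`, `B(x, y) := Tr_{L/F}(x (1 ⊗ β) ȳ)` satisfies the adjunction, is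
  alternating and non-degenerate (private §1: the same three facts over any `E ⊗_ℚ K`; the form exists as an `F`-bilinear
  map, `exists_bilinForm_eq_trace`); `rMu_hypotheses_inhabited` — the hypothesis set of the main theorem is INHABITED;
* `exists_isUnit_forall₂_eq_trace_muAlgValueField` — UNIT FORM «∃ a ∈ L^×: B(e(x a), e(y a)) = Tr(x (1 ⊗ β) ȳ)», the shape of the
  CM-side owner's `Def45.IsRMuNormalisable` (HCMISOG-TABLE v5.7, pin-2 g3);
* `exists_linearEquiv_forall₂_eq_trace_muAlgValueField_of_action` — the main theorem for consumers presenting the free orbit by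
  an ACTION HOM `act : L →ₐ[F] End_F(H)` and a generator `ω` (e.g. an `L`-stable `F`-form of `H¹(A_ℂ; ℂ)`), `r` then `F`-linear
  and intertwining.

HONEST SCOPE.  Nothing here constructs `H_1^{dR}(A_μ/E)` or discharges an END display binder (`R`/`hR` stay displayed, owner
position (α′), HOME/INBOX l.7627); HC_CM is NOT proved.  No named fact, no `def` (D-0026 debt 0).

References: [Liu2021] §4.1 l. 1928, Def. 4.5 (2) (TeX ll. 1955–1957), proof of Prop. 4.6 (1) (l. 1982); [Shimura1998] G. Shimura,
*Abelian Varieties with Complex Multiplication and Modular Functions* (1998), §6.2 («`E(v(α), v(β)) = Tr_{K/ℚ}(ζαβ^ρ)`», «`ζ^ρ = -ζ`») and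
Theorem 4 (3) with its converse.
-/

set_option autoImplicit false

noncomputable section

open scoped TensorProduct ComplexConjugate
open Module NumberField

namespace Literature.NumberTheory.Automorphic.Liu2021.Def45

/-! ## §1 The target trace form `Tr_{L/E}(x (1 ⊗ β) ȳ)` on `L = E ⊗_ℚ K` is an abstract de Rham datum -/

section Twist

variable {E K : Type} [Field E] [Algebra ℚ E] [Field K] [NumberField K] (ρ : K →ₐ[ℚ] K)

/-- The target form `(x, y) ↦ Tr_{L/E}(x c ȳ)` EXISTS as an `E`-bilinear form on `L = E ⊗_ℚ K` (for any `c ∈ L`): `E`-linearity in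
`x` by `(a • x) c ȳ = a • (x c ȳ)`, in `y` because `1 ⊗ ρ` is `E`-linear. [cite: Liu2021, Def. 4.5 (2) fourth bullet (TeX l. 1957)] -/
theorem exists_bilinForm_eq_trace (c : E ⊗[ℚ] K) :
    ∃ B : LinearMap.BilinForm E (E ⊗[ℚ] K), ∀ x y : E ⊗[ℚ] K,
      B x y = Algebra.trace E (E ⊗[ℚ] K) (x * c * Algebra.TensorProduct.map (AlgHom.id E E) ρ y) := by
  refine ⟨LinearMap.mk₂ E
      (fun x y => Algebra.trace E (E ⊗[ℚ] K) (x * c * Algebra.TensorProduct.map (AlgHom.id E E) ρ y))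
      (fun x₁ x₂ y => by simp only [add_mul, map_add])
      (fun a x y => by simp only [smul_mul_assoc, map_smul])
      (fun x y₁ y₂ => by simp only [map_add, mul_add])
      (fun a x y => by simp only [map_smul, mul_smul_comm]), fun x y => rfl⟩

/-- The target form `Tr_{L/E}(x (1 ⊗ β) ȳ)` satisfies the third-bullet adjunction. [cite: Liu2021, Def. 4.5 (2) (TeX ll. 1955–1957)] -/
private theorem traceFormTwist_tmul_mul (hρ : ∀ x, ρ (ρ x) = x) (B : LinearMap.BilinForm E (E ⊗[ℚ] K)) (β : K)
    (hB : ∀ x y : E ⊗[ℚ] K,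
      B x y = Algebra.trace E (E ⊗[ℚ] K) (x * ((1 : E) ⊗ₜ[ℚ] β) * Algebra.TensorProduct.map (AlgHom.id E E) ρ y))
    (x : K) (u v : E ⊗[ℚ] K) :
    B (((1 : E) ⊗ₜ[ℚ] x) * u) v = B u (((1 : E) ⊗ₜ[ℚ] ρ x) * v) := by
  rw [hB, hB, map_mul (Algebra.TensorProduct.map (AlgHom.id E E) ρ), Algebra.TensorProduct.map_tmul,
    AlgHom.id_apply, hρ]
  congr 1
  ring

/-- The target form `Tr_{L/E}(x (1 ⊗ β) ȳ)` is alternating when `ρ β = -β`. [cite: Liu2021, Def. 4.5 (2) fourth bullet (TeX l. 1957)] -/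
private theorem isAlt_traceFormTwist (hρ : ∀ x, ρ (ρ x) = x) (B : LinearMap.BilinForm E (E ⊗[ℚ] K)) (β : K) (hβ : ρ β = -β)
    (hB : ∀ x y : E ⊗[ℚ] K,
      B x y = Algebra.trace E (E ⊗[ℚ] K) (x * ((1 : E) ⊗ₜ[ℚ] β) * Algebra.TensorProduct.map (AlgHom.id E E) ρ y)) :
    B.IsAlt := by
  set bar := Algebra.TensorProduct.map (AlgHom.id E E) ρ with hbar
  have hbb : ∀ z, bar (bar z) = z := map_map_tensorProduct_of_involutive ρ hρ
  have htr : ∀ z, Algebra.trace E (E ⊗[ℚ] K) (bar z) = Algebra.trace E (E ⊗[ℚ] K) z :=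
    trace_map_tensorProduct_of_involutive ρ hρ
  intro x
  have hβ' : bar ((1 : E) ⊗ₜ[ℚ] β) = -((1 : E) ⊗ₜ[ℚ] β) := by
    rw [hbar, Algebra.TensorProduct.map_tmul, AlgHom.id_apply, hβ, TensorProduct.tmul_neg]
  have h : Algebra.trace E (E ⊗[ℚ] K) (x * ((1 : E) ⊗ₜ[ℚ] β) * bar x) =
      -Algebra.trace E (E ⊗[ℚ] K) (x * ((1 : E) ⊗ₜ[ℚ] β) * bar x) := by
    conv_lhs => rw [← htr, map_mul bar, map_mul bar, hbb, hβ']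
    rw [← map_neg]
    congr 1
    ring
  haveI : CharZero E := charZero_of_injective_algebraMap (algebraMap ℚ E).injective
  rw [hB]
  exact CharZero.eq_neg_self_iff.mp h

/-- The target form `Tr_{L/E}(x (1 ⊗ β) ȳ)` is non-degenerate when `β ≠ 0`. [cite: Liu2021, Def. 4.5 (2) fourth bullet (TeX l. 1957)] -/
private theorem nondegenerate_traceFormTwist (hρ : ∀ x, ρ (ρ x) = x) (B : LinearMap.BilinForm E (E ⊗[ℚ] K)) (β : K)
    (hβ0 : β ≠ 0)
    (hB : ∀ x y : E ⊗[ℚ] K,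
      B x y = Algebra.trace E (E ⊗[ℚ] K) (x * ((1 : E) ⊗ₜ[ℚ] β) * Algebra.TensorProduct.map (AlgHom.id E E) ρ y)) :
    B.Nondegenerate := by
  set bar := Algebra.TensorProduct.map (AlgHom.id E E) ρ with hbar
  have hbb : ∀ z, bar (bar z) = z := map_map_tensorProduct_of_involutive ρ hρ
  have hβinv : ((1 : E) ⊗ₜ[ℚ] β : E ⊗[ℚ] K) * ((1 : E) ⊗ₜ[ℚ] β⁻¹) = 1 := by
    rw [Algebra.TensorProduct.tmul_mul_tmul, one_mul, mul_inv_cancel₀ hβ0, ← Algebra.TensorProduct.one_def]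
  refine ⟨fun x hx => ?_, fun y hy => ?_⟩
  · -- left: `Tr(x (1⊗β) bar y) = 0` for all `y`; take `y = bar ((1 ⊗ β⁻¹) z)`
    refine eq_zero_of_forall_trace_mul_eq_zero E K fun z => ?_
    have h := hx (bar (((1 : E) ⊗ₜ[ℚ] β⁻¹) * z))
    rw [hB, hbb, show x * ((1 : E) ⊗ₜ[ℚ] β) * (((1 : E) ⊗ₜ[ℚ] β⁻¹) * z) =
      ((1 : E) ⊗ₜ[ℚ] β) * ((1 : E) ⊗ₜ[ℚ] β⁻¹) * (x * z) by ring, hβinv, one_mul] at h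
    exact h
  · -- right: `Tr(x (1⊗β) bar y) = 0` for all `x` ⇒ `bar y = 0`
    have hby : bar y = 0 := by
      refine eq_zero_of_forall_trace_mul_eq_zero E K fun z => ?_
      have h := hy (((1 : E) ⊗ₜ[ℚ] β⁻¹) * z)
      rw [hB, show ((1 : E) ⊗ₜ[ℚ] β⁻¹) * z * ((1 : E) ⊗ₜ[ℚ] β) * bar y =
        ((1 : E) ⊗ₜ[ℚ] β) * ((1 : E) ⊗ₜ[ℚ] β⁻¹) * (bar y * z) by ring, hβinv, one_mul] at h
      exact h
    rw [← hbb y, hby, map_zero]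

end Twist

/-! ## §2 Liu's data: `β` exists; the printed shape; joint satisfiability -/

section Liu

open Literature.NumberTheory.ComplexMultiplication
open Literature.NumberTheory.Automorphic.IdeleClassGroup

variable {F : Type} [Field F] [NumberField F] [IsCMField F] {μ : IdeleClassGroup F →ₜ* Circle}

/-- Non-vacuity of the prescribed `β`: `M_μ` (a CM field) contains a non-zero `β` with `ρ β = -β` (`β := w - ρ w` for any
`w` moved by complex conjugation — `M_μ` is a CM field, tree `IsConjugateSymplectic.isCMField_muAlgValueField`, and the complex
conjugation of a CM field is not the identity, Mathlib `IsCMField.complexConj_ne_one`).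
[cite: Liu2021, §4.1 (TeX l. 1928) and Def. 4.5 (2) fourth bullet (l. 1957)] -/
theorem exists_map_eq_neg_ne_zero_muAlgValueField (hμ : IdeleClassGroup.IsConjugateSymplectic F μ)
    (ρ : muAlgValueField F μ →ₐ[ℚ] muAlgValueField F μ)
    (hρ : ∀ x, ((ρ x : muAlgValueField F μ) : ℂ) = conj (x : ℂ)) :
    ∃ β : muAlgValueField F μ, ρ β = -β ∧ β ≠ 0 := by
  haveI := hμ.numberField_muAlgValueField
  haveI := hμ.isCMField_muAlgValueField
  -- `ρ` IS the complex conjugation of the CM field `M_μ` (both induce `conj` along `M_μ ⊆ ℂ`)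
  have hρc : ∀ w : muAlgValueField F μ, ρ w = IsCMField.complexConj (muAlgValueField F μ) w := fun w =>
    Subtype.ext (by
      rw [hρ]
      exact (IsCMField.complexEmbedding_complexConj (muAlgValueField F μ) (muAlgValueField F μ).subtype w).symm)
  -- complex conjugation of a CM field moves some element
  obtain ⟨w, hw⟩ : ∃ w : muAlgValueField F μ, IsCMField.complexConj (muAlgValueField F μ) w ≠ w := by
    by_contra hc
    push Not at hc
    exact IsCMField.complexConj_ne_one (muAlgValueField F μ) (AlgEquiv.ext hc)
  refine ⟨w - ρ w, ?_, ?_⟩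
  · rw [map_sub, conj_algHom_involutive ρ hρ, neg_sub]
  · intro h0
    apply hw
    rw [← hρc, eq_comm, ← sub_eq_zero]
    exact h0

/-- **Unconditional corollary at Liu's data (no prescribed `β`)**: at every face of a Galois CM field, every abstract de
Rham datum `(H, e, B)` for `μ` admits an `r` and a `β ∈ M_μ` with `B(r x, r y) = Tr(x (1 ⊗ β) ȳ)` — literally the
fourth bullet's «there exist an element `β ∈ M_μ` and … such that …» with `c` absorbed into `B`.
[cite: Liu2021, Def. 4.5 (2) fourth bullet (TeX l. 1957) and proof of Prop. 4.6 (1) (l. 1982)] -/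
theorem exists_beta_linearEquiv_forall₂_eq_trace_muAlgValueField [IsGalois ℚ F]
    (hμ : IdeleClassGroup.IsConjugateSymplectic F μ)
    (ρ : muAlgValueField F μ →ₐ[ℚ] muAlgValueField F μ)
    (hρ : ∀ x, ((ρ x : muAlgValueField F μ) : ℂ) = conj (x : ℂ))
    {H : Type} [AddCommGroup H] [Module F H] [Module (F ⊗[ℚ] muAlgValueField F μ) H]
    [IsScalarTower F (F ⊗[ℚ] muAlgValueField F μ) H]
    (e : (F ⊗[ℚ] muAlgValueField F μ) ≃ₗ[F ⊗[ℚ] muAlgValueField F μ] H) (B : LinearMap.BilinForm F H)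
    (hRos : ∀ (x : muAlgValueField F μ) (u v : H),
      B (((1 : F) ⊗ₜ[ℚ] x) • u) v = B u (((1 : F) ⊗ₜ[ℚ] ρ x) • v))
    (hAlt : B.IsAlt) (hNd : B.Nondegenerate) :
    ∃ (β : muAlgValueField F μ) (r : (F ⊗[ℚ] muAlgValueField F μ) ≃ₗ[F ⊗[ℚ] muAlgValueField F μ] H),
      ρ β = -β ∧ β ≠ 0 ∧ ∀ x y : F ⊗[ℚ] muAlgValueField F μ,
        B (r x) (r y) = Algebra.trace F (F ⊗[ℚ] muAlgValueField F μ)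
          (x * ((1 : F) ⊗ₜ[ℚ] β) * Algebra.TensorProduct.map (AlgHom.id F F) ρ y) := by
  obtain ⟨β, hβ, hβ0⟩ := exists_map_eq_neg_ne_zero_muAlgValueField hμ ρ hρ
  obtain ⟨r, hr⟩ := exists_linearEquiv_forall₂_eq_trace_muAlgValueField hμ ρ hρ e B hRos hAlt hNd β hβ hβ0
  exact ⟨β, r, hβ, hβ0, hr⟩

/-- **Joint satisfiability of the hypotheses at Liu's data** (no vacuous antecedent): for every conjugate symplectic `μ` of
a CM field `F`, `ρ` complex conjugation on `M_μ` and `β ∈ M_μ` with `ρ β = -β`, `β ≠ 0` (which exists,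
`exists_map_eq_neg_ne_zero_muAlgValueField`), the target datum `H := F ⊗_ℚ M_μ`, `e := id`, `B(x, y) := Tr(x (1 ⊗ β) ȳ)`
satisfies ALL hypotheses of `exists_linearEquiv_forall₂_eq_trace_muAlgValueField` (adjunction, alternating,
non-degenerate). [cite: Liu2021, Def. 4.5 (2) fourth bullet (TeX l. 1957)] [cite: Shimura1998, §6.2 Theorem 4] -/
theorem rMu_hypotheses_satisfiable (hμ : IdeleClassGroup.IsConjugateSymplectic F μ)
    (ρ : muAlgValueField F μ →ₐ[ℚ] muAlgValueField F μ)
    (hρ : ∀ x, ((ρ x : muAlgValueField F μ) : ℂ) = conj (x : ℂ))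
    (β : muAlgValueField F μ) (hβ : ρ β = -β) (hβ0 : β ≠ 0)
    (B : LinearMap.BilinForm F (F ⊗[ℚ] muAlgValueField F μ))
    (hB : ∀ x y : F ⊗[ℚ] muAlgValueField F μ,
      B x y = Algebra.trace F (F ⊗[ℚ] muAlgValueField F μ)
        (x * ((1 : F) ⊗ₜ[ℚ] β) * Algebra.TensorProduct.map (AlgHom.id F F) ρ y)) :
    (∀ (x : muAlgValueField F μ) (u v : F ⊗[ℚ] muAlgValueField F μ),
        B (((1 : F) ⊗ₜ[ℚ] x) • u) v = B u (((1 : F) ⊗ₜ[ℚ] ρ x) • v)) ∧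
      B.IsAlt ∧ B.Nondegenerate := by
  haveI := hμ.numberField_muAlgValueField
  have hρ2 := conj_algHom_involutive ρ hρ
  refine ⟨fun x u v => ?_, isAlt_traceFormTwist ρ hρ2 B β hβ hB, nondegenerate_traceFormTwist ρ hρ2 B β hβ0 hB⟩
  rw [smul_eq_mul, smul_eq_mul]
  exact traceFormTwist_tmul_mul ρ hρ2 B β hB x u v

/-- **The hypothesis set of the main theorem is INHABITED at Liu's data** (every conjugate symplectic `μ` of a CM field `F`,
`ρ` complex conjugation on `M_μ`): there are `β ∈ M_μ` (`ρ β = -β ≠ 0`), an `L`-module `H` with `e : L ≃ₗ[L] H` and an `F`-bilinear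
`B` on `H` with the adjunction, alternating and non-degenerate — namely `H := L = F ⊗_ℚ M_μ`, `e := id`, `B := Tr(x (1 ⊗ β) ȳ)`.
[cite: Liu2021, Def. 4.5 (2) fourth bullet (TeX l. 1957)] [cite: Shimura1998, §6.2 Theorem 4] -/
theorem rMu_hypotheses_inhabited (hμ : IdeleClassGroup.IsConjugateSymplectic F μ)
    (ρ : muAlgValueField F μ →ₐ[ℚ] muAlgValueField F μ)
    (hρ : ∀ x, ((ρ x : muAlgValueField F μ) : ℂ) = conj (x : ℂ)) :
    ∃ (β : muAlgValueField F μ) (B : LinearMap.BilinForm F (F ⊗[ℚ] muAlgValueField F μ)),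
      ρ β = -β ∧ β ≠ 0 ∧
      (∀ (x : muAlgValueField F μ) (u v : F ⊗[ℚ] muAlgValueField F μ),
          B (((1 : F) ⊗ₜ[ℚ] x) • u) v = B u (((1 : F) ⊗ₜ[ℚ] ρ x) • v)) ∧
        B.IsAlt ∧ B.Nondegenerate := by
  haveI := hμ.numberField_muAlgValueField
  obtain ⟨β, hβ, hβ0⟩ := exists_map_eq_neg_ne_zero_muAlgValueField hμ ρ hρ
  obtain ⟨B, hB⟩ := exists_bilinForm_eq_trace ρ ((1 : F) ⊗ₜ[ℚ] β)
  exact ⟨β, B, hβ, hβ0, rMu_hypotheses_satisfiable hμ ρ hρ β hβ hβ0 B hB⟩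

/-- **Unit form of the main theorem** (the shape of the CM-side owner's `Def45.IsRMuNormalisable`, HCMISOG-TABLE v5.7: «∃ `a ∈ (E ⊗ M_μ)^×`,
`β ∈ M_μ` with `c₀ Q((a x)·w₀, (a y)·w₀) = Tr(x (1 ⊗ β) ȳ)`»): with `e : L ≃ H` the orbit map `ℓ ↦ ℓ·w₀` of a free rank-one datum, for every
prescribed `β` there is a UNIT `a ∈ L` with `B(e(x a), e(y a)) = Tr_{L/F}(x (1 ⊗ β) ȳ)` for all `x, y` (`a := e⁻¹(r 1)` for the `r` of the main
theorem; every `L`-linear automorphism of `L` is `x ↦ x a`). [cite: Liu2021, Def. 4.5 (2) fourth bullet (TeX l. 1957) and proof of Prop. 4.6 (1) (l. 1982)] -/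
theorem exists_isUnit_forall₂_eq_trace_muAlgValueField [IsGalois ℚ F]
    (hμ : IdeleClassGroup.IsConjugateSymplectic F μ)
    (ρ : muAlgValueField F μ →ₐ[ℚ] muAlgValueField F μ)
    (hρ : ∀ x, ((ρ x : muAlgValueField F μ) : ℂ) = conj (x : ℂ))
    {H : Type} [AddCommGroup H] [Module F H] [Module (F ⊗[ℚ] muAlgValueField F μ) H]
    [IsScalarTower F (F ⊗[ℚ] muAlgValueField F μ) H]
    (e : (F ⊗[ℚ] muAlgValueField F μ) ≃ₗ[F ⊗[ℚ] muAlgValueField F μ] H) (B : LinearMap.BilinForm F H)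
    (hRos : ∀ (x : muAlgValueField F μ) (u v : H),
      B (((1 : F) ⊗ₜ[ℚ] x) • u) v = B u (((1 : F) ⊗ₜ[ℚ] ρ x) • v))
    (hAlt : B.IsAlt) (hNd : B.Nondegenerate)
    (β : muAlgValueField F μ) (hβ : ρ β = -β) (hβ0 : β ≠ 0) :
    ∃ a : F ⊗[ℚ] muAlgValueField F μ, IsUnit a ∧ ∀ x y : F ⊗[ℚ] muAlgValueField F μ,
      B (e (x * a)) (e (y * a)) = Algebra.trace F (F ⊗[ℚ] muAlgValueField F μ)
        (x * ((1 : F) ⊗ₜ[ℚ] β) * Algebra.TensorProduct.map (AlgHom.id F F) ρ y) := by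
  obtain ⟨r, hr⟩ := exists_linearEquiv_forall₂_eq_trace_muAlgValueField hμ ρ hρ e B hRos hAlt hNd β hβ hβ0
  have hra : ∀ x, r x = e (x * e.symm (r 1)) := fun x => by
    rw [← smul_eq_mul, LinearEquiv.map_smul, LinearEquiv.apply_symm_apply, ← LinearEquiv.map_smul, smul_eq_mul, mul_one]
  refine ⟨e.symm (r 1), ?_, fun x y => by rw [← hra, ← hra]; exact hr x y⟩
  -- `x ↦ e⁻¹ (r x) = x · e⁻¹(r 1)` is onto, so `e⁻¹(r 1)` is a unit
  obtain ⟨x, hx⟩ := (r.trans e.symm).surjective 1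
  rw [LinearEquiv.trans_apply, hra, LinearEquiv.symm_apply_apply] at hx
  exact IsUnit.of_mul_eq_one_right x hx

/-- **Action-hom form of the main theorem** (for consumers presenting the free rank-one orbit by an ACTION MAP rather than a
`Module` instance — e.g. an `F ⊗_ℚ M_μ`-stable `F`-form `H` of `H¹(A_ℂ; ℂ)` with the action induced by `i_μ`): `act : L →ₐ[F] End_F(H)`,
a vector `ω ∈ H` with `ℓ ↦ act ℓ ω` bijective (free of rank one), `B` alternating, non-degenerate, with
`B(act(1 ⊗ x) u, v) = B(u, act(1 ⊗ ρ x) v)`; then for every `β ∈ M_μ`, `ρ β = -β ≠ 0`, there is an `F`-linear isomorphism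
`r : L ≃ H` intertwining multiplication with `act` and with `B(r x, r y) = Tr_{L/F}(x (1 ⊗ β) ȳ)`.
[cite: Liu2021, Def. 4.5 (2) fourth bullet (TeX l. 1957) and proof of Prop. 4.6 (1) (l. 1982)] -/
theorem exists_linearEquiv_forall₂_eq_trace_muAlgValueField_of_action [IsGalois ℚ F]
    (hμ : IdeleClassGroup.IsConjugateSymplectic F μ)
    (ρ : muAlgValueField F μ →ₐ[ℚ] muAlgValueField F μ)
    (hρ : ∀ x, ((ρ x : muAlgValueField F μ) : ℂ) = conj (x : ℂ))
    {H : Type} [AddCommGroup H] [Module F H]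
    (act : (F ⊗[ℚ] muAlgValueField F μ) →ₐ[F] Module.End F H) (ω : H)
    (hω : Function.Bijective fun ℓ : F ⊗[ℚ] muAlgValueField F μ => act ℓ ω)
    (B : LinearMap.BilinForm F H)
    (hRos : ∀ (x : muAlgValueField F μ) (u v : H),
      B (act ((1 : F) ⊗ₜ[ℚ] x) u) v = B u (act ((1 : F) ⊗ₜ[ℚ] ρ x) v))
    (hAlt : B.IsAlt) (hNd : B.Nondegenerate)
    (β : muAlgValueField F μ) (hβ : ρ β = -β) (hβ0 : β ≠ 0) :
    ∃ r : (F ⊗[ℚ] muAlgValueField F μ) ≃ₗ[F] H,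
      (∀ ℓ x, r (ℓ * x) = act ℓ (r x)) ∧
      ∀ x y : F ⊗[ℚ] muAlgValueField F μ,
        B (r x) (r y) = Algebra.trace F (F ⊗[ℚ] muAlgValueField F μ)
          (x * ((1 : F) ⊗ₜ[ℚ] β) * Algebra.TensorProduct.map (AlgHom.id F F) ρ y) := by
  letI : Module (F ⊗[ℚ] muAlgValueField F μ) H := Module.compHom H act.toRingHom
  have hsmul : ∀ (ℓ : F ⊗[ℚ] muAlgValueField F μ) (h : H), ℓ • h = act ℓ h := fun _ _ => rfl
  haveI : IsScalarTower F (F ⊗[ℚ] muAlgValueField F μ) H := ⟨fun a ℓ h => by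
    rw [hsmul, hsmul, map_smul, LinearMap.smul_apply]⟩
  -- the `L`-linear isomorphism `ℓ ↦ act ℓ ω`
  let e₀ : (F ⊗[ℚ] muAlgValueField F μ) →ₗ[F ⊗[ℚ] muAlgValueField F μ] H :=
    { toFun := fun ℓ => act ℓ ω
      map_add' := fun a b => by rw [map_add, LinearMap.add_apply]
      map_smul' := fun a b => by rw [smul_eq_mul, map_mul, RingHom.id_apply, hsmul]; rfl }
  let e : (F ⊗[ℚ] muAlgValueField F μ) ≃ₗ[F ⊗[ℚ] muAlgValueField F μ] H := LinearEquiv.ofBijective e₀ hω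
  have hRos' : ∀ (x : muAlgValueField F μ) (u v : H),
      B (((1 : F) ⊗ₜ[ℚ] x) • u) v = B u (((1 : F) ⊗ₜ[ℚ] ρ x) • v) := fun x u v => by
    rw [hsmul, hsmul]; exact hRos x u v
  obtain ⟨r, hr⟩ := exists_linearEquiv_forall₂_eq_trace_muAlgValueField hμ ρ hρ e B hRos' hAlt hNd β hβ hβ0
  refine ⟨r.restrictScalars F, fun ℓ x => ?_, fun x y => hr x y⟩
  change r (ℓ * x) = act ℓ (r x)
  rw [← smul_eq_mul, LinearEquiv.map_smul, hsmul]

end Liu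

end Literature.NumberTheory.Automorphic.Liu2021.Def45

end
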